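import Literature.IUT.LogThetaLattice.HolomorphicLogShellsProofs
import Literature.IUT.LogThetaLattice.ThetaMonoidsThm22Cor23Proofs
import Literature.IUT.HodgeArakelov.TemperedThetaMonoidsProofs

/-!
# [IUTchIII] §1–2 cone closers RE-CLOSED against the surviving instance form of their refuted-closure input (C-R33 / K4)

abc-iut cell, sub-cell L-K/R-C (D-0079), seat abc-iut-L6-t5 gen 12, row «K4-RECLOSE-L6-IUTchIII». RULING C-R33
(abc-iut-plan g9, 2026-08-26T15:07:08Z): a cone node whose closing theorem binds a FACT-LIST row of class
«refuted-closure» as a hypothesis is discharged VACUOUSLY-AS-TYPED and does not count until it is re-closed against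
the row's surviving (instance) form. abc-iut-c312-2's `CONE-K4-RECLOSE.tsv` v3 (17:50Z) lists the affected nodes
and `CONE-FACT-PRODUCERS.tsv` (17:15Z) the CLOSED producers (theorems concluding an instance of the row from
non-FACT hypotheses only). This PROOF-ONLY file (no `def`, no Prop fact, no `instance`, no `sorry`) writes the two
[IUTchIII] re-closures that were NOT yet in the tree; the evidence table `K4-L6-RECLOSED.tsv` (HOME/staging) lists
all eight [IUTchIII] L6 nodes of class RECLOSABLE with their re-closing declaration (four of them pre-existing:
`GlobalFrobenioidModels.isPreFrobenioid_places`, `Prop310ii_nonInterference_places`,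
`LatticeGlue.ofKits_withRealifiedD_thm15v_singleIso_lattice` / `…_orbit_compat_horizontal`) or the reason no
genuine-carrier producer exists (F-1998 `FKit.RlfOfIsStrip`: only the datum form `rlfOfIsStrip_of_model`).

* `localLogVolume_logLink_ofUnitLog` — node `IUTchIII:Prop1.2(iii)`, closer `localLogVolume_logLink`
  (abc-iut-L6-t3, binder `h : LogLinkVolumeCompatible L e`, FACT row F-0429, class refuted-closure as a schema)
  RE-CLOSED at the GENUINE `p_v`-adic logarithm on units `L := PadicLogOnUnits.ofUnitLog p K` by the CLOSED producer
  `logLinkVolumeCompatible_ofUnitLog` (abc-iut-L6-d2, `HolomorphicLogShellsProofs.lean`): remaining hypotheses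
  = an ISOMETRIC identification `e : K ≃+* K'` (printed: log-volumes are intrinsic) and the closer's own set-side
  conditions on `A`.
* `thm22_ii_splitting_of_val` — node `IUTchIII:Thm2.2(ii)`, closer `thm22_ii_splitting_of_prop31` (abc-iut-w5-d0xx
  lineage, binder `hP : Prop31Statements E`, FACT row F-2567) RE-CLOSED by the CLOSED producer
  `TemperedThetaMonoids.prop31Statements_of_val` (abc-iut-L6-t2 companion, `TemperedThetaMonoidsProofs.lean`):
  remaining hypotheses = the printed inputs of [IUTchII] Prop. 3.1 in the shape Prop. 1.5 (iii) / Cor. 2.8 (i) /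
  Prop. 2.2 (i) deliver them (conjugation stabilises the constant monoid and permutes the `θ^ι_env`; a divisor
  valuation kills the units and is positive on `∞θ^ι_env`) — structural hypotheses on the datum `E`, not FACT rows.

HONEST FRAMING: re-closed ≠ endorsed; the remaining hypotheses are listed in each docstring; typed ≠
proved-as-printed; no side taken on [IUTchIII] Cor. 3.12; nothing here asserts that abc is proved or refuted.
[claim: Mochizuki2012, status: disputed]
-/

namespace Literature.IUT.LogThetaLattice

/-! ## IUTchIII:Prop1.2(iii) at the genuine `p_v`-adic logarithm on units -/

section Prop12iii

open Set Metric MeasureTheory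
open Literature.AnabelianGeometry.AbsoluteAnabelian

variable (p : ℕ) [Fact p.Prime]
variable (K : Type*) [NontriviallyNormedField K] [NormedAlgebra ℚ_[p] K] [IsUltrametricDist K]
  [ProperSpace K]

/-- **IUTchIII:Prop1.2(iii) RE-CLOSED (C-R33)** (kurims p.31: "At `v ∈ V̲^{non}`, the diagram (∗non) is compatible
with the natural `p_v`-adic log-volumes [cf. [AbsTopIII], Proposition 5.7, (i), (c); Corollary 5.10, (ii)]"):
abc-iut-L6-t3's closer `localLogVolume_logLink` with its binder `h : LogLinkVolumeCompatible L e` (FACT F-0429,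
refuted as a universal closure) SUPPLIED at the genuine logarithm `L := PadicLogOnUnits.ofUnitLog p K` by
`logLinkVolumeCompatible_ofUnitLog`: for every ISOMETRIC identification `e : K ≃+* K'` of `log(†F_v)` with the
codomain and every compact open `A ⊆ 𝒪_K^×`-sphere on which `log_p` is injective with compact open image, the
log-volume of `A` equals the log-volume of the image of `log_p(A)` in the codomain. Remaining hypotheses: `he`
(isometry) and the closer's set-side conditions — no FACT-LIST row. [claim: Mochizuki2012, status: disputed] -/
theorem localLogVolume_logLink_ofUnitLog [MeasurableSpace K] [BorelSpace K]
    {K' : Type*} [NontriviallyNormedField K'] [IsUltrametricDist K'] [ProperSpace K'] [MeasurableSpace K']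
    [BorelSpace K'] (e : K ≃+* K') (he : Isometry e)
    {A : Set K} (hA : A ∈ compactOpens K) (hAu : A ⊆ {x : K | ‖x‖ = 1})
    (hinj : InjOn (PadicLogOnUnits.ofUnitLog p K).log A)
    (himg : (PadicLogOnUnits.ofUnitLog p K).log '' A ∈ compactOpens K) :
    localLogVolume K' (e '' ((PadicLogOnUnits.ofUnitLog p K).log '' A)) = localLogVolume K A :=
  localLogVolume_logLink (PadicLogOnUnits.ofUnitLog p K) (logLinkVolumeCompatible_ofUnitLog p K e he) hA hAu hinj
    himg

end Prop12iii

/-! ## IUTchIII:Thm2.2(ii) (d_v) from the printed inputs of [IUTchII] Prop. 3.1 -/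

section Thm22ii

universe u v w

/-- **IUTchIII:Thm2.2(ii) (d_v) RE-CLOSED (C-R33)** (kurims p.65): the closer `thm22_ii_splitting_of_prop31` with its
binder `hP : Prop31Statements E` (FACT F-2567, refuted as a universal closure) SUPPLIED by abc-iut-L6-t2's CLOSED
producer `TemperedThetaMonoids.prop31Statements_of_val`: at a REAL mono-theta-theoretic theta-monoid datum `E`
([IUTchII] Prop. 3.1 (i)) in which (a) conjugation stabilises the constant monoid (`hcns`) and permutes the subsets
`θ^ι_env` (`hperm`), and (b) some divisor valuation `v` kills the units (`hU`) and is `> 1` on every `∞θ^ι_env`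
(`hpos`) — the shape in which Prop. 1.5 (iii) / Cor. 2.8 (i) / Prop. 2.2 (i) deliver the Prop. 3.1 inputs — and the
printed inclusion `_∞Ψ^μ ⊆ _∞Ψ^×` (`hμ`), the unit part and the `∞θ^ι_env`-part meet trivially in the
`×μ`-quotient, for every `ι`. Remaining hypotheses: structural, on the datum `E` — no FACT-LIST row.
[claim: Mochizuki2012, status: disputed] -/
theorem thm22_ii_splitting_of_val {P : Type u} [Group P]
    (E : Literature.IUT.HodgeArakelov.TemperedThetaMonoids.ThetaEnvData.{u, v} P)
    {Γ : Type w} [CommMonoid Γ] [PartialOrder Γ] [IsOrderedMonoid Γ]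
    (hcns : E.IsConjStable E.constantMonoid)
    (hperm : ∀ (g : P) (ι : E.Iota), ∃ ι' : E.Iota, E.conj g '' E.thetaEnv ι = E.thetaEnv ι')
    (v : E.H →* Γ) (hU : ∀ u ∈ E.units, v u = 1)
    (hpos : ∀ (ι : E.Iota), ∀ t ∈ E.inftyThetaEnv ι, 1 < v t)
    (hμ : CommGroup.torsion E.H ≤ E.units) (ι : E.Iota) :
    (E.units.map (QuotientGroup.mk' (CommGroup.torsion E.H)) : Set (E.H ⧸ CommGroup.torsion E.H)) ∩
        (QuotientGroup.mk' (CommGroup.torsion E.H)) ''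
          (Submonoid.closure (E.inftyThetaEnv ι) : Set E.H) = {1} :=
  thm22_ii_splitting_of_prop31 E
    (Literature.IUT.HodgeArakelov.TemperedThetaMonoids.prop31Statements_of_val E hcns hperm v hU hpos) hμ ι

end Thm22ii

end Literature.IUT.LogThetaLattice
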